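import Literature.AlgebraicGeometry.Motives.FamiliesVHSHom
import Literature.AlgebraicGeometry.HodgeTheory.VHSDataHodgeLocusOverPuncturedCompactCurve
import HarnessLib

/-!
# The MORPHISM LOCUS of a lattice map between two polarized variations of Hodge structure is a Hodge locus of `Hom(D₁, D₂)`; over a
# punctured compact curve it is everything or finite (Cattani–Deligne–Kaplan, Cor. 1.3 applied to `Hom(D₁, D₂)`)

Topic `Literature/AlgebraicGeometry/HodgeTheory` (namespace `Literature.AlgebraicGeometry.Motives.VHSData`), lane `lit-hodgefound` (seat `p08`, row g56-#12).
THEOREMS ONLY (no definition, no named fact, no instance; D-0026 net debt `0`).  The junction of `Motives/FamiliesVHSHom` (`Hom(D₁, D₂) = D₁^∨ ⊗ D₂`,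
`homClass`, `homRat`, `hom_VZ_transport_homClass`, `isHodgeAt_homClass_iff`) with the tree's one-dimensional Cor. 1.3 of Cattani–Deligne–Kaplan
(`HodgeTheory/VHSDataHodgeLocusOverPuncturedCompactCurve`, `determinationLocus_eq_univ_or_finite_of_compactification`).

PRINTED SOURCES.  E. Cattani, P. Deligne, A. Kaplan, *On the locus of Hodge classes*, J. Amer. Math. Soc. 8 (1995): Cor. 1.3 (p. 484) «the set of
`s` where some determination of `u` is of type `(p, p)` is an algebraic subvariety», and the remark after Cor. 1.4 (p. 484) that the theorem applies to
the variations deduced from `𝒱` by tensor operations — classically to `Hom(𝒱₁, 𝒱₂) = 𝒱₁^∨ ⊗ 𝒱₂`, whose Hodge classes of type `(0,0)` are the morphisms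
of Hodge structures (P. Deligne, *Théorie de Hodge II*, 1.1.6 ∕ 2.1; C. Voisin, *Hodge Theory I*, Lemma 7.25): the locus where a flat lattice map
`f_t = γ_* f γ_*⁻¹ : V₁,ℤ,t → V₂,ℤ,t` (an isogeny, a correspondence, an endomorphism) is a morphism of Hodge structures is a Hodge locus, hence algebraic
(the «tensorial Hodge loci» of B. Klingler, A. Otwinowska, D. Urbanik, *On the fields of definition of Hodge loci*, §1.1).

* §1 **`morphismLocus_eq_determinationLocus_homClass`** — for `D₁, D₂ : VHSData S k`, `s₀`, `f : V₁,ℤ,s₀ →ₗ[ℤ] V₂,ℤ,s₀`: the MORPHISM LOCUS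
  `{t | ∃ γ : s₀ ⇝ t, (γ_* ∘ f ∘ γ⁻¹_*)_ℚ is a morphism of Hodge structures V₁,t → V₂,t}` IS the determination locus
  `{t | ∃ γ, γ_*(homClass f) is a Hodge class of level 0 of Hom(D₁, D₂) at t}` (by `hom_VZ_transport_homClass` and `isHodgeAt_homClass_iff`).
* §2 **`morphismLocus_eq_univ_or_finite_of_compactification`** — CDK COR. 1.3 FOR THE MORPHISM LOCUS over a punctured compact curve: granted the flat
  interior and unipotent puncture period charts of the variation `Hom(D₁, D₂)` (hypotheses verbatim those of the tree's
  `determinationLocus_eq_univ_or_finite_of_compactification` for the datum `D₁.hom D₂`, weight `k − k`, level `0`), the morphism locus is ALL of `S`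
  or FINITE.

HONEST SCOPE: the period charts of `Hom(D₁, D₂)` are hypotheses (not derived from charts of `D₁`, `D₂`); equal weights only (morphisms of Hodge
structures); as everywhere for `VHSData`, holomorphy ∕ transversality are not recorded.

## References

* [CattaniDeligneKaplan1995] E. Cattani, P. Deligne, A. Kaplan, *On the locus of Hodge classes*, J. Amer. Math. Soc. 8 (1995) 483–506: Cor. 1.3,
  Cor. 1.4 and the remark following it (p. 484), «Proof of 1.5 ⟹ 1.1» (p. 485).
* [DeligneHodgeII1971] P. Deligne, *Théorie de Hodge II*, Publ. Math. IHÉS 40 (1971), 1.1.6, 2.1.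
* [VoisinHodgeI2002] C. Voisin, *Hodge Theory and Complex Algebraic Geometry I* (CUP, 2002), Lemma 7.25.
* [KlinglerOtwinowskaUrbanik2023] B. Klingler, A. Otwinowska, D. Urbanik, *On the fields of definition of Hodge loci*, Ann. Sci. ÉNS 56 (2023), §1.1.
* [Schmid1973] W. Schmid, *Variation of Hodge structure*, Invent. Math. 22 (1973), §2 (cite only).
-/

noncomputable section

open scoped TensorProduct ComplexOrder
open _root_.Topology _root_.Filter Set

namespace Literature.AlgebraicGeometry

open Module
open Motives Motives.MixedHodgeStructure Motives.HodgeStructure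
open Motives.HodgeStructure (conj ofRat ofRat_apply conj_ofRat)
open HodgeTheory

universe u

namespace Motives.VHSData

variable {S : Type} [TopologicalSpace S] {k : ℤ} (D₁ D₂ : VHSData S k)
variable {V : Type u} [AddCommGroup V] [Module ℚ V] [FiniteDimensional ℚ V]
variable {X : Type*} [TopologicalSpace X] [CompactSpace X]

/-! ## §1 The morphism locus is a determination locus of `Hom(D₁, D₂)` -/

/-- **The morphism locus of a lattice map is a Hodge locus of `Hom(D₁, D₂)`.**  For `D₁`, `D₂` of the same weight on `S`, `s₀ ∈ S` and a `ℤ`-linear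
`f : V₁,ℤ,s₀ → V₂,ℤ,s₀`: the set of `t ∈ S` such that for SOME path class `γ : s₀ ⇝ t` the flat continuation `γ_* ∘ f ∘ γ⁻¹_* : V₁,ℤ,t → V₂,ℤ,t`
rationalizes to a morphism of Hodge structures `(V₁,t, F) → (V₂,t, F)` equals the set of `t` where some determination of `homClass f` is an integral
Hodge class of level `0` of `Hom(D₁, D₂)`. [cite: DeligneHodgeII1971, 1.1.6 and 2.1] [cite: VoisinHodgeI2002, Lemma 7.25] [cite: CattaniDeligneKaplan1995, Cor. 1.3 and the remark after Cor. 1.4 (p. 484)] -/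
theorem morphismLocus_eq_determinationLocus_homClass (s₀ : S) (f : D₁.VZ.fiber s₀ →ₗ[ℤ] D₂.VZ.fiber s₀) :
    {t : S | ∃ γ : Path.Homotopic.Quotient s₀ t, ∀ q : ℤ,
        ((D₁.hodge t).F q).map ((D₁.homRat D₂ t (D₂.VZ.transport γ ∘ₗ f ∘ₗ D₁.VZ.transport γ.symm)).baseChange ℂ) ≤ (D₂.hodge t).F q} =
      {t : S | ∃ γ : Path.Homotopic.Quotient s₀ t, (D₁.hom D₂).IsHodgeAt t 0 ((D₁.hom D₂).VZ.transport γ (D₁.homClass D₂ s₀ f))} := by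
  ext t
  simp only [mem_setOf_eq, hom_VZ_transport_homClass, isHodgeAt_homClass_iff]

/-! ## §2 Cor. 1.3 for the morphism locus over a punctured compact curve -/

/-- **Cattani–Deligne–Kaplan, COROLLARY 1.3 FOR THE MORPHISM LOCUS OF A LATTICE MAP over a PUNCTURED COMPACT CURVE.**  `D₁`, `D₂` of the same weight
on a preconnected `S`, `f : V₁,ℤ,s₀ → V₂,ℤ,s₀` `ℤ`-linear; for the variation `Hom(D₁, D₂)` (weight `k − k`, level `0`) the flat interior period charts
with a metric comparison at every point, the flat unipotent puncture charts `Lᵢ, Γᵢ, Λᵢ, σᵢ, eᵢ`, and a compact `X ⊇ j(S)` with disc charts centred at the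
punctures — verbatim the hypotheses of the tree's `determinationLocus_eq_univ_or_finite_of_compactification` for the datum `D₁.hom D₂`.  Then **the
morphism locus `{t | ∃ γ : s₀ ⇝ t, (γ_* f γ_*⁻¹)_ℚ is a morphism of Hodge structures V₁,t → V₂,t}` is ALL of `S` or a FINITE set** («an algebraic
subvariety of `S`» on the curve). [cite: CattaniDeligneKaplan1995, Cor. 1.3 and the remark after Cor. 1.4 (p. 484), «Proof of 1.5 ⟹ 1.1» (p. 485)]
[cite: DeligneHodgeII1971, 1.1.6 and 2.1] [cite: KlinglerOtwinowskaUrbanik2023, §1.1] [cite: Schmid1973, §2 (cite only)] -/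
theorem morphismLocus_eq_univ_or_finite_of_compactification [PreconnectedSpace S] {s₀ : S} (f : D₁.VZ.fiber s₀ →ₗ[ℤ] D₂.VZ.fiber s₀)
    -- flat interior charts of `Hom(D₁, D₂)` at every point
    (hint : ∀ x : S, ∃ ψ : OpenPartialHomeomorph S ℂ, x ∈ ψ.source ∧ IsPreconnected ψ.target ∧
      ∃ (e : ∀ c : ℂ, (D₁.hom D₂).V.fiber (ψ.symm c) ≃ₗ[ℚ] V) (H₀ : HodgeStructure V (k - k)) (P₀ : H₀.Polarization) (h : ℂ → Module.End ℂ (ℂ ⊗[ℚ] V))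
        (Λ₀ : Submodule ℤ V) (κ : ℝ),
        (∀ (φ : Module.Dual ℂ (ℂ ⊗[ℚ] V)) (w : ℂ ⊗[ℚ] V), AnalyticOnNhd ℂ (fun c => φ (h c w)) ψ.target) ∧
        (∀ c ∈ ψ.target, (((D₁.hom D₂).hodge (ψ.symm c)).F 0).map ((e c).toLinearMap.baseChange ℂ) = (H₀.F 0).comap (h c)) ∧
        Λ₀.FG ∧ (∀ c ∈ ψ.target, ∀ u : (D₁.hom D₂).VZ.fiber (ψ.symm c), e c ((D₁.hom D₂).toRat (ψ.symm c) u) ∈ Λ₀) ∧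
        0 < κ ∧ (∀ c ∈ ψ.target, ∀ x : (D₁.hom D₂).V.fiber (ψ.symm c), κ * P₀.hodgeNorm (ofRat (e c x)) ≤ ((D₁.hom D₂).form (ψ.symm c)).hodgeNorm (ofRat x)) ∧
        (∀ c ∈ ψ.target, ∀ c' ∈ ψ.target, ∃ δ : Path.Homotopic.Quotient (ψ.symm c) (ψ.symm c'),
          ∀ y : (D₁.hom D₂).V.fiber (ψ.symm c), e c' ((D₁.hom D₂).V.transport δ y) = e c y))
    -- flat unipotent puncture charts of `Hom(D₁, D₂)`
    {ι : Type*} (L : ι → PolarizedLimitMixedHodgeStructure V (k - k)) (Γ : ι → ℂ → Module.End ℂ (ℂ ⊗[ℚ] V)) (hΓ0 : ∀ i, Γ i 0 = 0)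
    (hΓan : ∀ (i : ι) (φ : Module.Dual ℂ (ℂ ⊗[ℚ] V)) (w : ℂ ⊗[ℚ] V), AnalyticAt ℂ (fun s => φ (Γ i s w)) 0)
    (hΓb : ∀ (i : ι) (s : ℂ), Γ i s ∈ ⨆ ab ∈ {ab : ℤ × ℤ | ab.1 ≤ -1}, (L i).toMixedHodgeStructure.endPiece ab.1 ab.2)
    (Λ : ι → Submodule ℤ V) (hΛ : ∀ i, (Λ i).FG) (hΛT : ∀ i, ∀ u ∈ Λ i, (L i).monodromy u ∈ Λ i)
    (σ : ι → ℂ → S) (e : ∀ (i : ι) (z : ℂ), (D₁.hom D₂).V.fiber (σ i z) ≃ₗ[ℚ] V) (A₀ : ι → ℝ)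
    (hF : ∀ (i : ι) (z : ℂ), A₀ i ≤ z.im → (((D₁.hom D₂).hodge (σ i z)).F 0).map ((e i z).toLinearMap.baseChange ℂ) =
      (((L i).F 0).map (IsNilpotent.exp (Γ i (Complex.exp (2 * Real.pi * Complex.I * z))))).map (IsNilpotent.exp (z • (L i).N.baseChange ℂ)))
    (hQ : ∀ (i : ι) (z : ℂ), A₀ i ≤ z.im → ∀ x y : (D₁.hom D₂).V.fiber (σ i z), ((D₁.hom D₂).form (σ i z)).form x y = (L i).Q (e i z x) (e i z y))
    (hΛ₁ : ∀ (i : ι) (z : ℂ), A₀ i ≤ z.im → ∀ u : (D₁.hom D₂).VZ.fiber (σ i z), e i z ((D₁.hom D₂).toRat (σ i z) u) ∈ Λ i)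
    (hflat : ∀ (i : ι) (z z' : ℂ), A₀ i ≤ z.im → A₀ i ≤ z'.im → ∃ δ : Path.Homotopic.Quotient (σ i z) (σ i z'),
      ∀ y : (D₁.hom D₂).V.fiber (σ i z), e i z' ((D₁.hom D₂).V.transport δ y) = e i z y)
    -- the compactification with disc charts at the punctures
    {j : S → X} (hj : IsEmbedding j) (pt : ι → X) (hpS : ∀ i, pt i ∉ range j) (hcov : ∀ x : X, x ∉ range j → ∃ i, x = pt i)
    (φ : ι → OpenPartialHomeomorph X ℂ) (hp : ∀ i, pt i ∈ (φ i).source) (hφp : ∀ i, φ i (pt i) = 0)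
    (hball : ∀ i, Metric.ball (0 : ℂ) (Real.exp (-(2 * Real.pi * A₀ i))) ⊆ (φ i).target)
    (hσ : ∀ (i : ι) (z : ℂ), A₀ i < z.im → j (σ i z) = (φ i).symm (Complex.exp (2 * Real.pi * Complex.I * z))) :
    {t : S | ∃ γ : Path.Homotopic.Quotient s₀ t, ∀ q : ℤ,
        ((D₁.hodge t).F q).map ((D₁.homRat D₂ t (D₂.VZ.transport γ ∘ₗ f ∘ₗ D₁.VZ.transport γ.symm)).baseChange ℂ) ≤ (D₂.hodge t).F q} = univ ∨
      {t : S | ∃ γ : Path.Homotopic.Quotient s₀ t, ∀ q : ℤ,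
        ((D₁.hodge t).F q).map ((D₁.homRat D₂ t (D₂.VZ.transport γ ∘ₗ f ∘ₗ D₁.VZ.transport γ.symm)).baseChange ℂ) ≤ (D₂.hodge t).F q}.Finite := by
  rw [D₁.morphismLocus_eq_determinationLocus_homClass D₂ s₀ f]
  exact (D₁.hom D₂).determinationLocus_eq_univ_or_finite_of_compactification (p := 0) (by simp) (D₁.homClass D₂ s₀ f) hint L Γ hΓ0 hΓan
    hΓb Λ hΛ hΛT σ e A₀ hF hQ hΛ₁ hflat hj pt hpS hcov φ hp hφp hball hσ

end Motives.VHSData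

end Literature.AlgebraicGeometry

end
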